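import Mathlib
import Summits.Ventures.PercRepro2.Defs
import Summits.Ventures.PercRepro2.Graph
import Summits.Ventures.PercRepro2.Harris
import Summits.Ventures.PercRepro2.Events
import Summits.Ventures.PercRepro2.Independence
import Summits.Ventures.PercRepro2.Induced
import Summits.Ventures.PercRepro2.GateFeedbackForest
import Summits.Ventures.PercRepro2.HullTree
import Summits.Ventures.PercRepro2.SideCluster
import Summits.Ventures.PercRepro2.GateDefs
import Summits.Ventures.PercRepro2.GateAnatomy
import Summits.Ventures.PercRepro2.GateCylinder
import Summits.Ventures.PercRepro2.GateForest
import Summits.Ventures.PercRepro2.GateSplit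
import Summits.Ventures.PercRepro2.ForestCluster
import Summits.Ventures.PercRepro2.GateLSM
import Summits.Ventures.PercRepro2.GateForestPaths

/-!
# The feedback-vertex gate: the free one-sided gate when `G − t` is a forest
(blind cell PercRepro2, mine-c g9; proofs/MINEC-FEEDBACK.md)

Let `t` be the avoided vertex and suppose the graph of the edges NOT incident to `t` is a forest
(`Hull.IsForest (endsF ends t)`: every cycle of `G` passes through `t`). Then the class-B mass of
the root cluster, `massB W = P(C(s) = W ∧ w ∈ C(t) ∧ s ↮ t, u)`, is log-supermodular on
`Finset V`, hence the free one-sided gate `Gate.GateRow s {t} a b {u} {w}` holds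
(`GateLSM.gateRow_of_massB_logSupermod`).

Mechanism. For `W ∌ t`: `{C(s) = W}` in `G` is `{C_F(s) = W}` in the forest `F = G − t` together
with «all edges between `W` and `t` closed» (`clusterEvent_eq`), so
`P(C(s) = W) = P_F(C_F(s) = W) · ∏_{e ∈ E(W,t)} (1 − p_e)` (`prob_clusterEvent_eq`): the first factor
is log-modular on rooted subtrees (`ForestCluster.clusterLogSupermod_of_isForest`), the second is a
product over the edge set `E(W,t)`, which is modular in `W`. On `{C(s) = W}` the event `{w ∈ C(t)}`
is «some edge `{x,t}` is open and the unique `F`-path from `w` to `x` is open and avoids `W`»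
(`clusterEvent_inter_conn_eq`): a union of path cylinders indexed by
`GateForestPaths.avoidB (endsF ends t) w N W` (`N` = the neighbours of `t`), and the avoidance sets of
two rooted subtrees are NESTED (`GateForestPaths.avoidB_nested`), which makes this factor
log-supermodular too (`prob_hitT_mul_le`).
-/

namespace Summit.Ventures.PercRepro2

namespace GateFeedback

open scoped Classical

variable {V : Type*} {E : Type*} [Fintype E] [Fintype V]
variable {R : Type*} [Field R] [LinearOrder R] [IsStrictOrderedRing R]

/-! ## The hull-containment event `{w ∈ C(t)}` on `{C(s) = W}` -/

/-- The neighbours of `t` (vertices joined to `t` by some edge). -/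
noncomputable def nbrs (ends : E → Sym2 V) (t : V) : Finset V :=
  Finset.univ.filter fun x => ∃ e, ends e = s(x, t)

/-- Some edge between `x` and `t` is open. -/
def tEdgeOpen (ends : E → Sym2 V) (t x : V) : Set (Config E) :=
  {ω | ∃ e, ends e = s(x, t) ∧ ω e = true}

/-- `{w ↔ t in G − W}` when `G − t` is a forest: some neighbour `x` of `t` whose `F`-path from `w`
avoids `W` is joined to `w` by that (open) path and to `t` by an open edge. -/
noncomputable def hitT (ends : E → Sym2 V) (t w : V) (W : Finset V) : Set (Config E) :=
  ⋃ x ∈ GateForestPaths.avoidB (endsF ends t) w (nbrs ends t) W,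
    tEdgeOpen ends t x ∩ res ends t ⁻¹' GateForestPaths.hitCyl (endsF ends t) w x

omit [Fintype E] [Fintype V] in
/-- `t` is isolated in `G − t`. -/
lemma not_connF_t {ends : E → Sym2 V} {t : V} (σ : Config {e // e ∈ Ft ends t}) {y : V}
    (hy : y ≠ t) : ¬ Conn (endsF ends t) σ y t := by
  rintro ⟨q⟩
  cases hq : q.reverse with
  | nil => exact (hy rfl).elim
  | cons hadj r =>
    rw [openGraph_adj] at hadj
    obtain ⟨_, e, _, hends⟩ := hadj
    exact e.2 (by show t ∈ ends e.1; rw [show ends e.1 = endsF ends t e from rfl, hends]; exact Sym2.mem_mk_left _ _)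

omit [Fintype E] [Fintype V] in
/-- A walk of `G` from `y ≠ t` to `t` ends with an open edge `{x, t}` preceded by a walk avoiding
`t`: `y ↔ x` in `G − t` and some edge `{x,t}` is open. -/
lemma exists_last_edge {ends : E → Sym2 V} {t : V} {ω : Config E} {y : V} (hy : y ≠ t)
    (q : (openGraph ends ω).Walk y t) :
    ∃ x, Conn (endsF ends t) (res ends t ω) y x ∧ ∃ e, ends e = s(x, t) ∧ ω e = true := by
  have htq : t ∈ q.support := q.end_mem_support
  set q' := q.takeUntil t htq with hq'
  have hcount : q'.support.count t = 1 := q.count_support_takeUntil_eq_one htq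
  have hcount' : q'.reverse.support.count t = 1 := by
    rw [SimpleGraph.Walk.support_reverse, List.count_reverse]; exact hcount
  cases hq'' : q'.reverse with
  | nil => exact (hy rfl).elim
  | cons hadj r =>
    rename_i x
    have hr : t ∉ r.support := by
      rw [hq''] at hcount'
      rw [SimpleGraph.Walk.support_cons, List.count_cons_self] at hcount'
      intro hmem
      have := List.count_pos_iff.2 hmem
      omega
    refine ⟨x, connF_of_walk r.reverse (by rwa [SimpleGraph.Walk.support_reverse, List.mem_reverse]), ?_⟩
    rw [openGraph_adj] at hadj
    obtain ⟨_, e, he, hends⟩ := hadj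
    exact ⟨e, by rw [hends, Sym2.eq_swap], he⟩

omit [Fintype E] in
/-- On a path cylinder every vertex of the path is joined to its origin. -/
lemma conn_of_mem_hitCyl {E' : Type*} [Fintype E'] {ends' : E' → Sym2 V} {w x : V} {σ : Config E'}
    (hσ : σ ∈ GateForestPaths.hitCyl ends' w x) {v : V}
    (hv : v ∈ GateForestPaths.pathVerts ends' w x) : Conn ends' σ w v := by
  unfold GateForestPaths.hitCyl at hσ
  by_cases hr : (ForestCluster.allG ends').Reachable w x
  · simp only [hr, if_true] at hσ
    unfold GateForestPaths.pathVerts at hv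
    rw [dif_pos hr] at hv
    have hv' : v ∈ (GateForestPaths.tbPath ends' w x hr).1.support := List.mem_toFinset.1 hv
    refine ⟨((GateForestPaths.tbPath ends' w x hr).1.takeUntil v hv').transfer (openGraph ends' σ)
      fun f hf => ?_⟩
    induction f using Sym2.ind with
    | h a b =>
      have hf' := (GateForestPaths.tbPath ends' w x hr).1.edges_takeUntil_subset_edges hv' hf
      have hadj := (GateForestPaths.tbPath ends' w x hr).1.adj_of_mem_edges hf'
      obtain ⟨hne, e, _, hends⟩ := openGraph_adj.1 hadj
      have he : e ∈ GateForestPaths.pathEdges ends' w x := by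
        unfold GateForestPaths.pathEdges
        rw [dif_pos hr, GateForest.mem_edgeFinset, hends]; exact hf'
      rw [SimpleGraph.mem_edgeSet, openGraph_adj]
      exact ⟨hne, e, hσ e he, hends⟩
  · simp [hr] at hσ

/-- **The hull identity**: on `{C(s) = W}` (with `t, w ∉ W`), `{w ∈ C(t)} = hitT W`. -/
lemma clusterEvent_inter_conn_eq {ends : E → Sym2 V} {s t w : V}
    (hF : Hull.IsForest (endsF ends t)) (hw : w ≠ t) {W : Finset V} (hwW : w ∉ W) :
    clusterEvent ends s (↑W : Set V) ∩ {ω | Conn ends ω t w} =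
      clusterEvent ends s (↑W : Set V) ∩ hitT ends t w W := by
  ext ω
  simp only [Set.mem_inter_iff, Set.mem_setOf_eq, hitT, Set.mem_iUnion, Set.mem_preimage,
    tEdgeOpen, GateForestPaths.avoidB, Finset.mem_filter, exists_prop]
  constructor
  · rintro ⟨hW, hc⟩
    obtain ⟨q⟩ := conn_symm hc
    obtain ⟨x, hwx, e, hex, he⟩ := exists_last_edge hw q
    have hcyl : res ends t ω ∈ GateForestPaths.hitCyl (endsF ends t) w x := by
      rw [GateForestPaths.hitCyl_eq hF]; exact hwx
    refine ⟨hW, x, ⟨⟨by simp only [nbrs, Finset.mem_filter, Finset.mem_univ, true_and]; exact ⟨e, hex⟩,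
      fun v hv hvW => ?_⟩, ⟨e, hex, he⟩, hcyl⟩⟩
    -- `v` on the open path: `w ↔ v`, and `v ∈ C(s) = W` would give `w ∈ W`
    have hwv : Conn ends ω w v := conn_of_connF (conn_of_mem_hitCyl hcyl hv)
    have hsv : Conn ends ω s v := by
      have : v ∈ cluster ends ω s := by rw [mem_clusterEvent.1 hW]; exact Finset.mem_coe.2 hvW
      exact this
    have hsw : w ∈ cluster ends ω s := hsv.trans (conn_symm hwv)
    rw [mem_clusterEvent.1 hW] at hsw
    exact hwW (Finset.mem_coe.1 hsw)
  · rintro ⟨hW, x, ⟨_, _⟩, ⟨e, hex, he⟩, hcyl⟩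
    refine ⟨hW, ?_⟩
    rw [GateForestPaths.hitCyl_eq hF] at hcyl
    have hwx : Conn ends ω w x := conn_of_connF hcyl
    have hxt : x ≠ t := fun h => not_connF_t (res ends t ω) hw (h ▸ hcyl)
    have hadj : (openGraph ends ω).Adj x t := by rw [openGraph_adj]; exact ⟨hxt, e, he, hex⟩
    exact conn_symm (hwx.trans hadj.reachable)

/-! ## The class-B mass factorises -/

/-- `hitT` is monotone in the avoidance set. -/
lemma hitT_mono {ends : E → Sym2 V} {t w : V} {W₁ W₂ : Finset V}
    (h : GateForestPaths.avoidB (endsF ends t) w (nbrs ends t) W₁ ⊆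
      GateForestPaths.avoidB (endsF ends t) w (nbrs ends t) W₂) :
    hitT ends t w W₁ ⊆ hitT ends t w W₂ := by
  intro ω hω
  simp only [hitT, Set.mem_iUnion] at hω ⊢
  obtain ⟨x, hx, hω⟩ := hω
  exact ⟨x, h hx, hω⟩

/-- `hitT W` depends only on edges not touching `W` (for `t ∉ W`). -/
lemma dependsOn_hitT {ends : E → Sym2 V} {t w : V} {W : Finset V} (ht : t ∉ W) :
    DependsOn (· ∈ hitT ends t w W) (touches ends (↑W : Set V))ᶜ := by
  intro ω ω' h
  simp only [hitT, Set.mem_iUnion, Set.mem_inter_iff, Set.mem_preimage, tEdgeOpen,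
    Set.mem_setOf_eq, GateForestPaths.avoidB, Finset.mem_filter, exists_prop]
  refine propext (exists_congr fun x => and_congr_right fun hx => ?_)
  by_cases hr : (ForestCluster.allG (endsF ends t)).Reachable w x
  · have hxW : x ∉ W := by
      refine hx.2 x ?_
      unfold GateForestPaths.pathVerts
      rw [dif_pos hr]
      exact List.mem_toFinset.2 (GateForestPaths.tbPath (endsF ends t) w x hr).1.end_mem_support
    have h1 : (∃ e, ends e = s(x, t) ∧ ω e = true) ↔ ∃ e, ends e = s(x, t) ∧ ω' e = true := by
      refine exists_congr fun e => and_congr_right fun hex => ?_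
      have : e ∉ touches ends (↑W : Set V) := by
        rintro ⟨a, ha, b, hab⟩
        rw [hex] at hab
        rcases Sym2.eq_iff.1 hab with ⟨rfl, _⟩ | ⟨_, rfl⟩
        · exact hxW (Finset.mem_coe.1 ha)
        · exact ht (Finset.mem_coe.1 ha)
      rw [h e this]
    have h2 : (res ends t ω ∈ GateForestPaths.hitCyl (endsF ends t) w x) ↔
        res ends t ω' ∈ GateForestPaths.hitCyl (endsF ends t) w x := by
      have hd := GateForestPaths.dependsOn_hitCyl (endsF ends t) w x
      refine Iff.of_eq (hd ?_)
      intro e' he'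
      have he'' : e' ∈ GateForestPaths.pathEdges (endsF ends t) w x := Finset.mem_coe.1 he'
      show ω e'.1 = ω' e'.1
      refine h e'.1 ?_
      rintro ⟨a, ha, b, hab⟩
      obtain ⟨ha', hb'⟩ := GateForestPaths.mem_pathVerts_of_mem_pathEdges he'' hab
      exact hx.2 a ha' (Finset.mem_coe.1 ha)
    rw [h1, h2]
  · have : GateForestPaths.hitCyl (endsF ends t) w x = ∅ := by
      unfold GateForestPaths.hitCyl; rw [if_neg hr]
    simp [this]

omit [LinearOrder R] [IsStrictOrderedRing R] in
/-- **The class-B mass factorises**: `massB W = P(C(s) = W) · P(hitT W)` when `t, u, w ∉ W`,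
and `massB W = 0` otherwise. -/
theorem massB_eq (p : E → R) {ends : E → Sym2 V} {s t u w : V}
    (hF : Hull.IsForest (endsF ends t)) (hw : w ≠ t) (W : Finset V) :
    GateLSM.massB p ends s t u w W =
      if t ∈ W ∨ u ∈ W ∨ w ∈ W then 0 else
        prob p (clusterEvent ends s (↑W : Set V)) * prob p (hitT ends t w W) := by
  unfold GateLSM.massB
  split_ifs with h
  · -- the event is empty
    rw [show clusterEvent ends s (↑W : Set V) ∩ GateAnatomy.classB ends s t u w = ∅ from ?_, prob_empty]
    ext ω
    simp only [Set.mem_inter_iff, GateAnatomy.classB, mem_clusterInEvent, Set.mem_setOf_eq,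
      avoidAll, Set.mem_empty_iff_false, iff_false, not_and, mem_clusterEvent]
    intro hW hcw hav
    have hmem : ∀ v ∈ W, Conn ends ω s v := fun v hv => by
      have : v ∈ cluster ends ω s := by rw [hW]; exact Finset.mem_coe.2 hv
      exact this
    rcases h with h | h | h
    · exact hav t (by simp) (hmem t h)
    · exact hav u (by simp) (hmem u h)
    · exact hav t (by simp) ((hmem w h).trans (conn_symm hcw))
  · simp only [not_or] at h
    obtain ⟨ht, hu, hwW⟩ := h
    have hset : clusterEvent ends s (↑W : Set V) ∩ GateAnatomy.classB ends s t u w =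
        clusterEvent ends s (↑W : Set V) ∩ {ω | Conn ends ω t w} := by
      ext ω
      simp only [Set.mem_inter_iff, GateAnatomy.classB, mem_clusterInEvent, Set.mem_setOf_eq,
        avoidAll, mem_clusterEvent]
      constructor
      · rintro ⟨hW, hcw, _⟩; exact ⟨hW, hcw⟩
      · rintro ⟨hW, hcw⟩
        refine ⟨hW, hcw, fun v hv hc => ?_⟩
        have : v ∈ cluster ends ω s := hc
        rw [hW] at this
        simp only [Finset.mem_union, Finset.mem_singleton] at hv
        rcases hv with rfl | rfl
        · exact ht (Finset.mem_coe.1 this)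
        · exact hu (Finset.mem_coe.1 this)
    rw [hset, clusterEvent_inter_conn_eq hF hw hwW]
    exact prob_inter_eq_mul_of_dependsOn p disjoint_compl_right (dependsOn_clusterEvent ends s _)
      (dependsOn_hitT ht)

/-! ## Log-supermodularity -/

omit [Fintype E] [Fintype V] in
/-- The algebraic core: a product of three log-supermodular factors is log-supermodular. -/
lemma three_factor {a₁ a₂ a₃ a₄ b₁ b₂ b₃ b₄ c₁ c₂ c₃ c₄ : R}
    (ha : a₁ * a₂ ≤ a₃ * a₄) (hb : b₁ * b₂ = b₃ * b₄) (hc : c₁ * c₂ ≤ c₃ * c₄)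
    (hb0 : 0 ≤ b₃ * b₄) (hc0 : 0 ≤ c₁ * c₂) (hab0 : 0 ≤ a₃ * a₄ * (b₃ * b₄)) :
    a₁ * b₁ * c₁ * (a₂ * b₂ * c₂) ≤ a₃ * b₃ * c₃ * (a₄ * b₄ * c₄) := by
  calc a₁ * b₁ * c₁ * (a₂ * b₂ * c₂) = (a₁ * a₂) * (b₁ * b₂) * (c₁ * c₂) := by ring
    _ ≤ (a₃ * a₄) * (b₃ * b₄) * (c₃ * c₄) := by
        rw [hb]
        exact mul_le_mul (mul_le_mul_of_nonneg_right ha hb0) hc hc0 hab0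
    _ = a₃ * b₃ * c₃ * (a₄ * b₄ * c₄) := by ring

omit [Fintype E] [Fintype V] [LinearOrder R] [IsStrictOrderedRing R] in
/-- `prob` does not depend on the choice of the `DecidableEq` instance. -/
lemma prob_congr_inst {E' : Type*} [Fintype E'] (i₁ i₂ : DecidableEq E') (p : E' → R)
    (A : Set (Config E')) : @prob E' _ i₁ R _ p A = @prob E' _ i₂ R _ p A := by
  cases Subsingleton.elim i₁ i₂; rfl

omit [Fintype E] [Fintype V] [IsStrictOrderedRing R] [LinearOrder R] in
/-- A nonzero probability means a nonempty event (instance-parametric). -/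
lemma nonempty_of_prob_ne_zero {E' : Type*} [Fintype E'] [DecidableEq E'] {p : E' → R}
    {A : Set (Config E')} (h : prob p A ≠ 0) : A.Nonempty := by
  by_contra hne
  rw [Set.not_nonempty_iff_eq_empty] at hne
  exact h (by rw [hne, prob_empty])

/-- **THEOREM (feedback-vertex gate, FKG form).** If `G − t` is a forest, the class-B mass
`W ↦ P(C(s) = W ∧ w ∈ C(t) ∧ s ↮ t, u)` is log-supermodular on `Finset V`. -/
theorem massBLogSupermod_of_isForest_del {p : E → R} (hp : IsProbVec p) {ends : E → Sym2 V}
    {s t u w : V} (hF : Hull.IsForest (endsF ends t)) (hw : w ≠ t) :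
    GateLSM.MassBLogSupermod p ends s t u w := by
  intro W₁ W₂
  have hnn : ∀ W, 0 ≤ GateLSM.massB p ends s t u w W := fun W => prob_nonneg hp _
  by_cases h₁ : t ∈ W₁ ∨ u ∈ W₁ ∨ w ∈ W₁
  · rw [massB_eq p hF hw W₁, if_pos h₁, zero_mul]; exact mul_nonneg (hnn _) (hnn _)
  by_cases h₂ : t ∈ W₂ ∨ u ∈ W₂ ∨ w ∈ W₂
  · rw [massB_eq p hF hw W₂, if_pos h₂, mul_zero]; exact mul_nonneg (hnn _) (hnn _)
  simp only [not_or] at h₁ h₂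
  obtain ⟨ht₁, hu₁, hw₁⟩ := h₁
  obtain ⟨ht₂, hu₂, hw₂⟩ := h₂
  have hI : ¬ (t ∈ W₁ ∩ W₂ ∨ u ∈ W₁ ∩ W₂ ∨ w ∈ W₁ ∩ W₂) := by
    rintro (h | h | h)
    · exact ht₁ (Finset.mem_inter.1 h).1
    · exact hu₁ (Finset.mem_inter.1 h).1
    · exact hw₁ (Finset.mem_inter.1 h).1
  have hU : ¬ (t ∈ W₁ ∪ W₂ ∨ u ∈ W₁ ∪ W₂ ∨ w ∈ W₁ ∪ W₂) := by
    rintro (h | h | h)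
    · rcases Finset.mem_union.1 h with h | h
      · exact ht₁ h
      · exact ht₂ h
    · rcases Finset.mem_union.1 h with h | h
      · exact hu₁ h
      · exact hu₂ h
    · rcases Finset.mem_union.1 h with h | h
      · exact hw₁ h
      · exact hw₂ h
  have htI : t ∉ W₁ ∩ W₂ := fun h => ht₁ (Finset.mem_inter.1 h).1
  have htU : t ∉ W₁ ∪ W₂ := fun h => hU (Or.inl h)
  rw [massB_eq p hF hw W₁, massB_eq p hF hw W₂, massB_eq p hF hw (W₁ ∩ W₂),
    massB_eq p hF hw (W₁ ∪ W₂), if_neg (by simp only [not_or]; exact ⟨ht₁, hu₁, hw₁⟩),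
    if_neg (by simp only [not_or]; exact ⟨ht₂, hu₂, hw₂⟩), if_neg hI, if_neg hU,
    prob_clusterEvent_eq p ends s t ht₁, prob_clusterEvent_eq p ends s t ht₂,
    prob_clusterEvent_eq p ends s t htI, prob_clusterEvent_eq p ends s t htU]
  -- the three factors
  have hpF := IsProbVec.pF hp ends t
  have hνF : ∀ W, 0 ≤ prob (pF p ends t) (clusterEvent (endsF ends t) s (↑W : Set V)) :=
    fun W => prob_nonneg hpF _
  have hκ0 : ∀ W, 0 ≤ prob p (hitT ends t w W) := fun W => prob_nonneg hp _
  have hA : prob (pF p ends t) (clusterEvent (endsF ends t) s (↑W₁ : Set V)) *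
      prob (pF p ends t) (clusterEvent (endsF ends t) s (↑W₂ : Set V)) ≤
      prob (pF p ends t) (clusterEvent (endsF ends t) s (↑(W₁ ∩ W₂) : Set V)) *
      prob (pF p ends t) (clusterEvent (endsF ends t) s (↑(W₁ ∪ W₂) : Set V)) := by
    have h := ForestCluster.clusterLogSupermod_of_isForest (pF p ends t) hpF hF s W₁ W₂
    unfold clusterMass at h
    simp only [prob_congr_inst (fun a b => Classical.propDecidable (a = b))
      (inferInstance : DecidableEq {e // e ∈ Ft ends t})] at h
    exact h
  have hB := tau_mul p ends t W₁ W₂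
  -- if one of the forest masses vanishes the left side is `0`
  by_cases hz₁ : prob (pF p ends t) (clusterEvent (endsF ends t) s (↑W₁ : Set V)) = 0
  · rw [hz₁]
    simp only [zero_mul]
    exact mul_nonneg (mul_nonneg (mul_nonneg (hνF _) (tau_nonneg hp ends t _)) (hκ0 _))
      (mul_nonneg (mul_nonneg (hνF _) (tau_nonneg hp ends t _)) (hκ0 _))
  by_cases hz₂ : prob (pF p ends t) (clusterEvent (endsF ends t) s (↑W₂ : Set V)) = 0
  · rw [hz₂]
    simp only [zero_mul, mul_zero]
    exact mul_nonneg (mul_nonneg (mul_nonneg (hνF _) (tau_nonneg hp ends t _)) (hκ0 _))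
      (mul_nonneg (mul_nonneg (hνF _) (tau_nonneg hp ends t _)) (hκ0 _))
  -- both are rooted subtrees of the forest: the avoidance sets are nested
  obtain ⟨ω₁, hω₁⟩ := nonempty_of_prob_ne_zero hz₁
  obtain ⟨ω₂, hω₂⟩ := nonempty_of_prob_ne_zero hz₂
  have hr₁ := ForestCluster.isRootedSub_of_clusterEvent hω₁
  have hr₂ := ForestCluster.isRootedSub_of_clusterEvent hω₂
  have hC : prob p (hitT ends t w W₁) * prob p (hitT ends t w W₂) ≤
      prob p (hitT ends t w (W₁ ∩ W₂)) * prob p (hitT ends t w (W₁ ∪ W₂)) := by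
    rcases GateForestPaths.avoidB_nested (ends := endsF ends t) (t := w) (B := nbrs ends t) hF hr₁ hr₂
      with hle | hle
    · have e1 : hitT ends t w W₁ ⊆ hitT ends t w (W₁ ∪ W₂) :=
        hitT_mono (by rw [GateForestPaths.avoidB_union]; exact Finset.subset_inter le_rfl hle)
      have e2 : hitT ends t w W₂ ⊆ hitT ends t w (W₁ ∩ W₂) :=
        hitT_mono (Finset.subset_union_right.trans
          (GateForestPaths.avoidB_inter_supset (endsF ends t) w (nbrs ends t) W₁ W₂))
      calc prob p (hitT ends t w W₁) * prob p (hitT ends t w W₂)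
          ≤ prob p (hitT ends t w (W₁ ∪ W₂)) * prob p (hitT ends t w (W₁ ∩ W₂)) :=
            mul_le_mul (prob_mono hp e1) (prob_mono hp e2) (hκ0 _) (hκ0 _)
        _ = _ := mul_comm _ _
    · have e1 : hitT ends t w W₂ ⊆ hitT ends t w (W₁ ∪ W₂) :=
        hitT_mono (by rw [GateForestPaths.avoidB_union]; exact Finset.subset_inter hle le_rfl)
      have e2 : hitT ends t w W₁ ⊆ hitT ends t w (W₁ ∩ W₂) :=
        hitT_mono (Finset.subset_union_left.trans
          (GateForestPaths.avoidB_inter_supset (endsF ends t) w (nbrs ends t) W₁ W₂))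
      exact mul_le_mul (prob_mono hp e2) (prob_mono hp e1) (hκ0 _) (hκ0 _)
  exact three_factor hA hB hC
    (mul_nonneg (tau_nonneg hp ends t _) (tau_nonneg hp ends t _)) (mul_nonneg (hκ0 _) (hκ0 _))
    (mul_nonneg (mul_nonneg (hνF _) (hνF _))
      (mul_nonneg (tau_nonneg hp ends t _) (tau_nonneg hp ends t _)))

/-! ## The gate -/

/-- **Class B is positively associated when `G − t` is a forest.** -/
theorem covC_classB_nonneg_of_isForest_del {p : E → R} (hp : IsProbVec p) {ends : E → Sym2 V}
    (s t a b u w : V) (hF : Hull.IsForest (endsF ends t)) (hw : w ≠ t) :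
    0 ≤ GateAnatomy.covC p ends s a b (GateAnatomy.classB ends s t u w) :=
  GateLSM.covC_classB_nonneg ends s t a b u w hp (massBLogSupermod_of_isForest_del hp hF hw)

/-- **THEOREM (the feedback-vertex gate).** If every cycle of `G` passes through the avoided vertex
`t` (`G − t` is a forest), the free one-sided gate holds for every root `s`, markers `a, b` and gate
vertices `u, w ≠ t`: `Gate.GateRow s {t} a b {u} {w}`. -/
theorem gateRow_of_isForest_del {p : E → R} (hp : IsProbVec p) {ends : E → Sym2 V}
    (s t a b u w : V) (hF : Hull.IsForest (endsF ends t)) (hw : w ≠ t) :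
    Gate.GateRow p ends s {t} a b {u} {w} :=
  GateForest.gateRow_of_covC_nonneg p ends s t a b u w hp
    (GateLSM.covC_classA_nonneg ends s t a b w hp)
    (covC_classB_nonneg_of_isForest_del hp s t a b u w hF hw)

end GateFeedback

end Summit.Ventures.PercRepro2
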